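import Summits.Ventures.PercRepro.GenQTenEightGapType

/-!
# PercRepro — the `(10, 8)` row modulo the type gap (night-4, gen 19)
`rls_ten_eight_of_type_gap : HighLayersEightResidual → TraceSevenResidue → ∀ M, RLS M 10 8` — the row of C-025 at `(p, q) = (10, 8)`
from the `137` gap cases of `typeGapEight` (GenQTenEightGap) and the trace residue `TraceSevenResidue` (GenQTraceEightAll): the type
layer is closed modulo its gap by `highLayersEightResidue_of_gap` (GenQTenEightGapType), the rest is `rls_ten_eight_of_finite_residues`
(GenQTenEightResidue).
-/
namespace PercRepro.Night4

open Finset ThmH SixFour GenQ PerFlat Star NightThree ThmN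

/-- **THE `(10, 8)` ROW MODULO THE TYPE GAP AND THE TRACE RESIDUE**: `RLS M 10 8` for every finite matroid from
`HighLayersEightResidual` (the `137` uncertified type cases) and `TraceSevenResidue` (the `513` trace sub-instances). -/
theorem rls_ten_eight_of_type_gap {γ : Type} [DecidableEq γ] (h1 : HighLayersEightResidual) (htr : TraceSevenResidue)
    (M : Matroid γ) [M.Finite] : RLS M 10 8 :=
  rls_ten_eight_of_finite_residues (highLayersEightResidue_of_gap h1) htr M

end PercRepro.Night4
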